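import Summits.Ventures.LatticeQCDFlow.Scaling.DominatedStarRetunedCeiling
import Summits.Ventures.LatticeQCDFlow.Scaling.DominatedStarGapAndMixing
import Summits.Ventures.LatticeQCDFlow.Scaling.HubCollectorLaw

/-!
HONEST FRAMING: exact (Metropolis-corrected) sampling algorithms for lattice gauge theory; figures
of merit are autocorrelation/cost numbers at stated couplings and volumes; no continuum-physics
claim.

# DominatedStarRetunedConstants — THE RETUNED CEILING AT ITS NATURAL HUB WEIGHTS: ONE-SIDED DOMINATION WITH `b = 2t/h`
# (`h = (1−t)w_0`, regime `2t ≤ p·h`) GIVES RATE `tc(p − 2t/h)/m` AND `γ⋆ ≥ tc(p − 2t/h)/m`; PERFECT TRANSPORTS WITH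
# `b* = t(m+c)/(t(m+c) + hm)` GIVE RATE `tch/(m(t+h) + tc)`, `γ⋆ ≥ tch/(m(t+h)+tc)`, AND FOR THE HOT-ONLY STAR AT `m = cK`
# THE LAW `(K/t − 1)·log(K/4) ≤ t_mix(1/4) ≤ ⌈((K+t)/(t(1−t)))·log(4(K+b*)/b*)⌉` — THE TWO SIDES AGREE UP TO THE
# FACTOR `1/(1−t)` AND THE LOGARITHM'S ARGUMENT (lean-2 GEN-26, ours)

Venture-side (OURS).  Cell `lqcd-flow` (pub-lqcd), unit `pub-lqcd-lean-2-g26`, 2026-08-27.  Chapter M (the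
coupon-collector ceiling without perfect transports), file 18 — the constants of `Scaling/DominatedStarRetunedCeiling`
at the hub weights that (nearly) optimise the rate, and their spectral reading through
`Scaling/DominatedStarGapAndMixing` (`d(n) ≤ Cρⁿ ⇒ λ⋆ ≤ ρ`).

## What is proved

* §1 **`retunedStar_absSpectralGap_ge`** — one-sided domination, reversible cold kernels, every `b ∈ (0,p]` with
  `2t ≤ (1−t)w_0·b`: `γ⋆ ≥ tc(p−b)/m`; **`oddsStar_worstTvDist_le`**, **`oddsStar_absSpectralGap_ge`** — at the swap-odds
  weight `b = 2t/((1−t)w_0)` (admissible iff `2t ≤ p(1−t)w_0`): `d(n) ≤ ((K+b)/b)(1 − tc(p−b)/m)ⁿ` and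
  `γ⋆ ≥ tc(p − 2t/((1−t)w_0))/m` — the full coupon rate `tcp/m` up to the swap odds.
* §2 **`retunedPerfectStar_absSpectralGap_ge`** — perfect maps, every admissible `b`: `γ⋆ ≥ tc(1−b)/m`;
  **`bestPerfectStar_worstTvDist_le`**, **`bestPerfectStar_absSpectralGap_ge`**, **`bestPerfectStar_mixingTime_le`** — at
  `b* = t(m+c)/(t(m+c) + (1−t)w_0·m)`: rate and gap `tc(1−b*)/m = tch/(m(t+h)+tc)`.
* §3 **`hotOnlyPerfectStar_mixingTime_two_sided`** — hot-only updates, `m = cK`, `K ≥ 2`, `0 < t < 1`, reversible cold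
  kernels, rare cold start: **`(K/t − 1)·log(K/4) ≤ t_mix(1/4) ≤ ⌈((K+t)/(t(1−t)))·log((K+b*)/(b*/4))⌉`** with
  `b* = t(K+1)/(K+t)`.

Reading (no numerics implied): for the perfectly transported (or idealised) hub the cold-start mixing time is now
located between `(K/t)·log K` and `(K/(t(1−t)))·log(K/t)` up to additive lower-order terms: the swap fraction enters
both sides as `1/t`, the hot refresh only the ceiling, as `1/(1−t)`.  Whether the truth carries the factor `1/(1−t)` —
a stale hub hands its content to a clean replica with odds `t : (1−t)` before it is refreshed — is left open here (the
collector floor does not see refreshes at all).  NOT CLAIMED: optimality of `b*`; anything measured.  Literature grade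
(cell rule): OWN RESULT; nothing cited as a fact; no new bib keys.
-/

noncomputable section

open Finset Function
open Literature.Probability.MarkovChains

namespace Summit.Ventures.LatticeQCDFlow.Scaling

variable {S : Type*} [Fintype S] [DecidableEq S] {K m : ℕ} {μ : Fin (K + 1) → S → ℝ} {M : Fin (K + 1) → S → S → ℝ}
  {w : Fin (K + 1) → ℝ} {t p : ℝ}

section Constants
variable (κ : Fin m → Fin K) (φ : Fin m → Equiv.Perm S)

/-! ## §1 One-sided domination -/

/-- **`γ⋆ ≥ tc(p−b)/m` FOR EVERY ADMISSIBLE HUB WEIGHT** (`0 < b ≤ p`, `2t ≤ (1−t)w_0·b`; reversible cold kernels so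
that `π̃P = π̃`). [ours] -/
theorem retunedStar_absSpectralGap_ge (hm : 1 ≤ m) (ht0 : 0 ≤ t) (ht1 : t ≤ 1) (hw0 : ∀ k, 0 ≤ w k)
    (hw1 : ∑ k, w k = 1) (hμ : ∀ k x, 0 < μ k x) (hμ1 : ∀ k, ∑ u, μ k u = 1) (hM : ∀ k, IsRowStochastic (M k))
    (hMrev : ∀ k, DetailedBalance (μ k) (M k)) (hM0 : ∀ u v, M 0 u v = μ 0 v) (hp0 : 0 < p) (hp1 : p ≤ 1)
    (hdom : ∀ r u, p * μ (κ r).succ (φ r u) ≤ μ 0 u) {b : ℝ} (hb0 : 0 < b) (hbp : b < p)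
    (hreg : 2 * t ≤ (1 - t) * w 0 * b) {c : ℕ} (hc1 : 1 ≤ c)
    (hc : ∀ p' : Fin K, c ≤ (univ.filter (fun r : Fin m => κ r = p')).card) (hcm : c ≤ m) (ht : 0 < t) :
    t * c * (p - b) / m ≤ absSpectralGap (fun y z : Fin (K + 1) → S =>
        t * ptGraphSwap μ (fun r : Fin m => (((0 : Fin (K + 1)), (κ r).succ) : Fin (K + 1) × Fin (K + 1))) φ y z
          + (1 - t) * prodKernel w M y z) := by
  have hstat : ∀ k : Fin (K + 1), k ≠ 0 → ∀ v, ∑ u, μ k u * M k u v = μ k v :=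
    fun k _ v => (hMrev k).isStationary (hM k).2 v
  have hmpos : (0 : ℝ) < m := Nat.cast_pos.mpr (by omega)
  have hcpos : (0 : ℝ) < c := Nat.cast_pos.mpr (by omega)
  have hcm' : (c : ℝ) ≤ m := by exact_mod_cast hcm
  have hρ : 0 < 1 - t * c * (p - b) / m := by
    rw [sub_pos, div_lt_one hmpos]
    have h1 : c * (p - b) < m * 1 := by nlinarith
    nlinarith
  have h := absSpectralGap_ge_of_worstTvDist_le_geom (dominatedStar_isStationary κ φ ht0 ht1 hw0 hw1 hμ hM hMrev) hρ
    (retunedStar_worstTvDist_le κ φ hm ht0 ht1 hw0 hw1 hμ hμ1 hM hM0 hstat hp0 hp1 hdom hb0 hbp.le hreg hc hcm)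
  linarith

/-- **THE SWAP-ODDS WEIGHT `b = 2t/((1−t)w_0)`** (admissible iff `2t ≤ p(1−t)w_0`, `0 < t < 1`, `w_0 > 0`):
**`d(n) ≤ ((K+b)/b)·(1 − tc(p−b)/m)ⁿ`** with `b = 2t/((1−t)w_0)`. [ours] -/
theorem oddsStar_worstTvDist_le (hm : 1 ≤ m) (ht0 : 0 < t) (ht1 : t < 1) (hw0 : ∀ k, 0 ≤ w k) (hw00 : 0 < w 0)
    (hw1 : ∑ k, w k = 1) (hμ : ∀ k x, 0 < μ k x) (hμ1 : ∀ k, ∑ u, μ k u = 1) (hM : ∀ k, IsRowStochastic (M k))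
    (hM0 : ∀ u v, M 0 u v = μ 0 v) (hstat : ∀ k : Fin (K + 1), k ≠ 0 → ∀ v, ∑ u, μ k u * M k u v = μ k v)
    (hp0 : 0 < p) (hp1 : p ≤ 1) (hdom : ∀ r u, p * μ (κ r).succ (φ r u) ≤ μ 0 u) (hreg : 2 * t ≤ p * ((1 - t) * w 0))
    {c : ℕ} (hc : ∀ p' : Fin K, c ≤ (univ.filter (fun r : Fin m => κ r = p')).card) (hcm : c ≤ m) (n : ℕ) :
    worstTvDist (fun y z : Fin (K + 1) → S =>
        t * ptGraphSwap μ (fun r : Fin m => (((0 : Fin (K + 1)), (κ r).succ) : Fin (K + 1) × Fin (K + 1))) φ y z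
          + (1 - t) * prodKernel w M y z) (tensorFun μ) n
      ≤ ((K : ℝ) + 2 * t / ((1 - t) * w 0)) / (2 * t / ((1 - t) * w 0))
          * (1 - t * c * (p - 2 * t / ((1 - t) * w 0)) / m) ^ n := by
  have hh : 0 < (1 - t) * w 0 := mul_pos (by linarith) hw00
  have hb0 : 0 < 2 * t / ((1 - t) * w 0) := div_pos (by linarith) hh
  have hbp : 2 * t / ((1 - t) * w 0) ≤ p := by rw [div_le_iff₀ hh]; linarith
  have hreg' : 2 * t ≤ (1 - t) * w 0 * (2 * t / ((1 - t) * w 0)) := by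
    rw [mul_div_cancel₀ _ hh.ne']
  exact retunedStar_worstTvDist_le κ φ hm ht0.le ht1.le hw0 hw1 hμ hμ1 hM hM0 hstat hp0 hp1 hdom hb0 hbp hreg' hc hcm n

/-- **`γ⋆ ≥ tc(p − 2t/((1−t)w_0))/m` AT THE SWAP-ODDS WEIGHT** (`2t < p(1−t)w_0`, reversible cold kernels). [ours] -/
theorem oddsStar_absSpectralGap_ge (hm : 1 ≤ m) (ht0 : 0 < t) (ht1 : t < 1) (hw0 : ∀ k, 0 ≤ w k) (hw00 : 0 < w 0)
    (hw1 : ∑ k, w k = 1) (hμ : ∀ k x, 0 < μ k x) (hμ1 : ∀ k, ∑ u, μ k u = 1) (hM : ∀ k, IsRowStochastic (M k))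
    (hMrev : ∀ k, DetailedBalance (μ k) (M k)) (hM0 : ∀ u v, M 0 u v = μ 0 v) (hp0 : 0 < p) (hp1 : p ≤ 1)
    (hdom : ∀ r u, p * μ (κ r).succ (φ r u) ≤ μ 0 u) (hreg : 2 * t < p * ((1 - t) * w 0))
    {c : ℕ} (hc1 : 1 ≤ c) (hc : ∀ p' : Fin K, c ≤ (univ.filter (fun r : Fin m => κ r = p')).card) (hcm : c ≤ m) :
    t * c * (p - 2 * t / ((1 - t) * w 0)) / m ≤ absSpectralGap (fun y z : Fin (K + 1) → S =>
        t * ptGraphSwap μ (fun r : Fin m => (((0 : Fin (K + 1)), (κ r).succ) : Fin (K + 1) × Fin (K + 1))) φ y z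
          + (1 - t) * prodKernel w M y z) := by
  have hh : 0 < (1 - t) * w 0 := mul_pos (by linarith) hw00
  have hb0 : 0 < 2 * t / ((1 - t) * w 0) := div_pos (by linarith) hh
  have hbp : 2 * t / ((1 - t) * w 0) < p := by rw [div_lt_iff₀ hh]; linarith
  have hreg' : 2 * t ≤ (1 - t) * w 0 * (2 * t / ((1 - t) * w 0)) := by
    rw [mul_div_cancel₀ _ hh.ne']
  exact retunedStar_absSpectralGap_ge κ φ hm ht0.le ht1.le hw0 hw1 hμ hμ1 hM hMrev hM0 hp0 hp1 hdom hb0 hbp hreg' hc1 hc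
    hcm ht0

/-! ## §2 Perfect transports -/

/-- **`γ⋆ ≥ tc(1−b)/m` FOR EVERY ADMISSIBLE HUB WEIGHT WITH PERFECT TRANSPORTS** (`0 < b < 1`,
`(1−b)·t·(1+c/m) ≤ (1−t)w_0·b`, reversible cold kernels). [ours] -/
theorem retunedPerfectStar_absSpectralGap_ge (hm : 1 ≤ m) (ht0 : 0 < t) (ht1 : t ≤ 1) (hw0 : ∀ k, 0 ≤ w k)
    (hw1 : ∑ k, w k = 1) (hμ : ∀ k x, 0 < μ k x) (hμ1 : ∀ k, ∑ u, μ k u = 1) (hM : ∀ k, IsRowStochastic (M k))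
    (hMrev : ∀ k, DetailedBalance (μ k) (M k)) (hM0 : ∀ u v, M 0 u v = μ 0 v)
    (hperf : ∀ r u, μ (κ r).succ (φ r u) = μ 0 u) {c : ℕ} (hc1 : 1 ≤ c)
    (hc : ∀ p' : Fin K, c ≤ (univ.filter (fun r : Fin m => κ r = p')).card) (hcm : c ≤ m)
    {b : ℝ} (hb0 : 0 < b) (hb1 : b < 1) (hreg : (1 - b) * t * (1 + (c : ℝ) / m) ≤ (1 - t) * w 0 * b) :
    t * c * (1 - b) / m ≤ absSpectralGap (fun y z : Fin (K + 1) → S =>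
        t * ptGraphSwap μ (fun r : Fin m => (((0 : Fin (K + 1)), (κ r).succ) : Fin (K + 1) × Fin (K + 1))) φ y z
          + (1 - t) * prodKernel w M y z) := by
  have hstat : ∀ k : Fin (K + 1), k ≠ 0 → ∀ v, ∑ u, μ k u * M k u v = μ k v :=
    fun k _ v => (hMrev k).isStationary (hM k).2 v
  have hmpos : (0 : ℝ) < m := Nat.cast_pos.mpr (by omega)
  have hcpos : (0 : ℝ) < c := Nat.cast_pos.mpr (by omega)
  have hcm' : (c : ℝ) ≤ m := by exact_mod_cast hcm
  have hρ : 0 < 1 - t * c * (1 - b) / m := by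
    rw [sub_pos, div_lt_one hmpos]
    have h1 : c * (1 - b) < m * 1 := by nlinarith
    nlinarith
  have h := absSpectralGap_ge_of_worstTvDist_le_geom (dominatedStar_isStationary κ φ ht0.le ht1 hw0 hw1 hμ hM hMrev) hρ
    (retunedPerfectStar_worstTvDist_le κ φ hm ht0 ht1 hw0 hw1 hμ hμ1 hM hM0 hstat hperf hc hcm hb0 hb1.le hreg)
  linarith

/-- `1 − b* = (1−t)w_0·m/(t(m+c) + (1−t)w_0·m)` for `b* = t(m+c)/(t(m+c) + (1−t)w_0·m)`. [ours] -/
theorem bestWeight_one_sub (hm : 1 ≤ m) (ht0 : 0 < t) (hh : 0 < (1 - t) * w 0) (c : ℕ) :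
    1 - t * ((m : ℝ) + c) / (t * ((m : ℝ) + c) + (1 - t) * w 0 * m)
      = (1 - t) * w 0 * m / (t * ((m : ℝ) + c) + (1 - t) * w 0 * m) := by
  have hmpos : (0 : ℝ) < m := Nat.cast_pos.mpr (by omega)
  have hc0 : (0 : ℝ) ≤ c := Nat.cast_nonneg c
  have hden : t * ((m : ℝ) + c) + (1 - t) * w 0 * m ≠ 0 := ne_of_gt (by positivity)
  rw [one_sub_div hden]
  congr 1
  ring

/-- The rate at the best weight: `tc(1−b*)/m = tc(1−t)w_0/(t(m+c) + (1−t)w_0·m)`. [ours] -/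
theorem bestWeight_rate (hm : 1 ≤ m) (ht0 : 0 < t) (hh : 0 < (1 - t) * w 0) (c : ℕ) :
    t * c * (1 - t * ((m : ℝ) + c) / (t * ((m : ℝ) + c) + (1 - t) * w 0 * m)) / m
      = t * c * ((1 - t) * w 0) / (t * ((m : ℝ) + c) + (1 - t) * w 0 * m) := by
  have hmpos : (0 : ℝ) < m := Nat.cast_pos.mpr (by omega)
  rw [bestWeight_one_sub (w := w) hm ht0 hh c]
  have e : t * c * ((1 - t) * w 0 * m / (t * ((m : ℝ) + c) + (1 - t) * w 0 * m)) / m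
      = t * c * ((1 - t) * w 0) / (t * ((m : ℝ) + c) + (1 - t) * w 0 * m) * ((m : ℝ) / m) := by ring
  rw [e, div_self hmpos.ne', mul_one]

/-- The weight `b* = t(m+c)/(t(m+c) + (1−t)w_0·m)` is admissible with equality:
`(1−b*)·t·(1+c/m) = (1−t)w_0·b*`, and `0 < b* < 1` for `0 < t`, `(1−t)w_0 > 0`, `m ≥ 1`. [ours] -/
theorem bestWeight_admissible (hm : 1 ≤ m) (ht0 : 0 < t) (hh : 0 < (1 - t) * w 0) (c : ℕ) :
    0 < t * ((m : ℝ) + c) / (t * ((m : ℝ) + c) + (1 - t) * w 0 * m) ∧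
      t * ((m : ℝ) + c) / (t * ((m : ℝ) + c) + (1 - t) * w 0 * m) < 1 ∧
      (1 - t * ((m : ℝ) + c) / (t * ((m : ℝ) + c) + (1 - t) * w 0 * m)) * t * (1 + (c : ℝ) / m)
        ≤ (1 - t) * w 0 * (t * ((m : ℝ) + c) / (t * ((m : ℝ) + c) + (1 - t) * w 0 * m)) := by
  have hmpos : (0 : ℝ) < m := Nat.cast_pos.mpr (by omega)
  have hc0 : (0 : ℝ) ≤ c := Nat.cast_nonneg c
  have hnum : 0 < t * ((m : ℝ) + c) := by positivity
  have hden : 0 < t * ((m : ℝ) + c) + (1 - t) * w 0 * m := by positivity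
  refine ⟨div_pos hnum hden, ?_, le_of_eq ?_⟩
  · rw [div_lt_one hden]; nlinarith
  · rw [bestWeight_one_sub (w := w) hm ht0 hh c]
    have e2 : (m : ℝ) * (1 + (c : ℝ) / m) = m + c := by rw [mul_add, mul_one, mul_div_cancel₀ _ hmpos.ne']
    calc (1 - t) * w 0 * m / (t * ((m : ℝ) + c) + (1 - t) * w 0 * m) * t * (1 + (c : ℝ) / m)
        = (1 - t) * w 0 * t * ((m : ℝ) * (1 + (c : ℝ) / m)) / (t * ((m : ℝ) + c) + (1 - t) * w 0 * m) := by ring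
      _ = (1 - t) * w 0 * (t * ((m : ℝ) + c) / (t * ((m : ℝ) + c) + (1 - t) * w 0 * m)) := by rw [e2]; ring

/-- **THE BEST HUB WEIGHT WITH PERFECT TRANSPORTS:** `b* = t(m+c)/(t(m+c) + (1−t)w_0·m)`:
**`d(n) ≤ ((K+b*)/b*)·(1 − tc(1−b*)/m)ⁿ`**, the rate being `tc(1−b*)/m = tc(1−t)w_0/(m(t + (1−t)w_0) + tc)`. [ours] -/
theorem bestPerfectStar_worstTvDist_le (hm : 1 ≤ m) (ht0 : 0 < t) (ht1 : t < 1) (hw0 : ∀ k, 0 ≤ w k)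
    (hw00 : 0 < w 0) (hw1 : ∑ k, w k = 1) (hμ : ∀ k x, 0 < μ k x) (hμ1 : ∀ k, ∑ u, μ k u = 1)
    (hM : ∀ k, IsRowStochastic (M k)) (hM0 : ∀ u v, M 0 u v = μ 0 v)
    (hstat : ∀ k : Fin (K + 1), k ≠ 0 → ∀ v, ∑ u, μ k u * M k u v = μ k v) (hperf : ∀ r u, μ (κ r).succ (φ r u) = μ 0 u)
    {c : ℕ} (hc : ∀ p' : Fin K, c ≤ (univ.filter (fun r : Fin m => κ r = p')).card) (hcm : c ≤ m) (n : ℕ) :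
    worstTvDist (fun y z : Fin (K + 1) → S =>
        t * ptGraphSwap μ (fun r : Fin m => (((0 : Fin (K + 1)), (κ r).succ) : Fin (K + 1) × Fin (K + 1))) φ y z
          + (1 - t) * prodKernel w M y z) (tensorFun μ) n
      ≤ ((K : ℝ) + t * ((m : ℝ) + c) / (t * ((m : ℝ) + c) + (1 - t) * w 0 * m))
            / (t * ((m : ℝ) + c) / (t * ((m : ℝ) + c) + (1 - t) * w 0 * m))
          * (1 - t * c * (1 - t * ((m : ℝ) + c) / (t * ((m : ℝ) + c) + (1 - t) * w 0 * m)) / m) ^ n := by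
  obtain ⟨hb0, hb1, hreg⟩ := bestWeight_admissible (w := w) hm ht0 (mul_pos (by linarith) hw00) c
  exact retunedPerfectStar_worstTvDist_le κ φ hm ht0 ht1.le hw0 hw1 hμ hμ1 hM hM0 hstat hperf hc hcm hb0 hb1.le hreg n

/-- **`γ⋆ ≥ tc(1−t)w_0/(t(m+c) + (1−t)w_0·m)` WITH PERFECT TRANSPORTS** (reversible cold kernels). [ours] -/
theorem bestPerfectStar_absSpectralGap_ge (hm : 1 ≤ m) (ht0 : 0 < t) (ht1 : t < 1) (hw0 : ∀ k, 0 ≤ w k)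
    (hw00 : 0 < w 0) (hw1 : ∑ k, w k = 1) (hμ : ∀ k x, 0 < μ k x) (hμ1 : ∀ k, ∑ u, μ k u = 1)
    (hM : ∀ k, IsRowStochastic (M k)) (hMrev : ∀ k, DetailedBalance (μ k) (M k)) (hM0 : ∀ u v, M 0 u v = μ 0 v)
    (hperf : ∀ r u, μ (κ r).succ (φ r u) = μ 0 u) {c : ℕ} (hc1 : 1 ≤ c)
    (hc : ∀ p' : Fin K, c ≤ (univ.filter (fun r : Fin m => κ r = p')).card) (hcm : c ≤ m) :
    t * c * ((1 - t) * w 0) / (t * ((m : ℝ) + c) + (1 - t) * w 0 * m) ≤ absSpectralGap (fun y z : Fin (K + 1) → S =>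
        t * ptGraphSwap μ (fun r : Fin m => (((0 : Fin (K + 1)), (κ r).succ) : Fin (K + 1) × Fin (K + 1))) φ y z
          + (1 - t) * prodKernel w M y z) := by
  have hh : 0 < (1 - t) * w 0 := mul_pos (by linarith) hw00
  obtain ⟨hb0, hb1, hreg⟩ := bestWeight_admissible (w := w) hm ht0 hh c
  rw [← bestWeight_rate (w := w) hm ht0 hh c]
  exact retunedPerfectStar_absSpectralGap_ge κ φ hm ht0 ht1.le hw0 hw1 hμ hμ1 hM hMrev hM0 hperf hc1 hc hcm hb0 hb1 hreg

/-- **`t_mix(ε) ≤ ⌈((t(m+c) + (1−t)w_0·m)/(tc(1−t)w_0))·log((K+b*)/(b*ε))⌉` WITH PERFECT TRANSPORTS.** [ours] -/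
theorem bestPerfectStar_mixingTime_le (hm : 1 ≤ m) (ht0 : 0 < t) (ht1 : t < 1) (hw0 : ∀ k, 0 ≤ w k)
    (hw00 : 0 < w 0) (hw1 : ∑ k, w k = 1) (hμ : ∀ k x, 0 < μ k x) (hμ1 : ∀ k, ∑ u, μ k u = 1)
    (hM : ∀ k, IsRowStochastic (M k)) (hM0 : ∀ u v, M 0 u v = μ 0 v)
    (hstat : ∀ k : Fin (K + 1), k ≠ 0 → ∀ v, ∑ u, μ k u * M k u v = μ k v) (hperf : ∀ r u, μ (κ r).succ (φ r u) = μ 0 u)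
    {c : ℕ} (hc1 : 1 ≤ c) (hc : ∀ p' : Fin K, c ≤ (univ.filter (fun r : Fin m => κ r = p')).card) (hcm : c ≤ m)
    {ε : ℝ} (hε : 0 < ε) :
    mixingTime (fun y z : Fin (K + 1) → S =>
        t * ptGraphSwap μ (fun r : Fin m => (((0 : Fin (K + 1)), (κ r).succ) : Fin (K + 1) × Fin (K + 1))) φ y z
          + (1 - t) * prodKernel w M y z) (tensorFun μ) ε
      ≤ ⌈(t * ((m : ℝ) + c) + (1 - t) * w 0 * m) / (t * c * ((1 - t) * w 0))
          * Real.log (((K : ℝ) + t * ((m : ℝ) + c) / (t * ((m : ℝ) + c) + (1 - t) * w 0 * m))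
            / (t * ((m : ℝ) + c) / (t * ((m : ℝ) + c) + (1 - t) * w 0 * m) * ε))⌉₊ := by
  have hh : 0 < (1 - t) * w 0 := mul_pos (by linarith) hw00
  obtain ⟨hb0, hb1, hreg⟩ := bestWeight_admissible (w := w) hm ht0 hh c
  have h := retunedPerfectStar_mixingTime_le κ φ hm ht0 ht1.le hw0 hw1 hμ hμ1 hM hM0 hstat hperf hc1 hc hcm hb0 hb1 hreg hε
  have hmpos : (0 : ℝ) < m := Nat.cast_pos.mpr (by omega)
  have hcpos : (0 : ℝ) < c := Nat.cast_pos.mpr (by omega)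
  have e : (m : ℝ) / (t * c * (1 - t * ((m : ℝ) + c) / (t * ((m : ℝ) + c) + (1 - t) * w 0 * m)))
      = (t * ((m : ℝ) + c) + (1 - t) * w 0 * m) / (t * c * ((1 - t) * w 0)) := by
    rw [bestWeight_one_sub (w := w) hm ht0 hh c]
    rw [show t * (c : ℝ) * ((1 - t) * w 0 * m / (t * ((m : ℝ) + c) + (1 - t) * w 0 * m))
        = t * c * ((1 - t) * w 0) * m / (t * ((m : ℝ) + c) + (1 - t) * w 0 * m) by ring]
    rw [div_div_eq_mul_div, mul_comm (m : ℝ) _, mul_div_mul_right _ _ hmpos.ne']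
  rw [e] at h
  exact h

/-! ## §3 The hot-only star at `m = cK`: both sides -/

/-- **THE HOT-ONLY PERFECT STAR AT `m = cK`, BOTH SIDES:** perfect transports, hot-only updates, `0 < t < 1`, `K ≥ 2`,
reversible cold kernels (never used by the dynamics), a configuration `x` with `Σ_k μ_{k+1}(x_{k+1}) ≤ 1/4`, and
`b* = t(K+1)/(t(K+1) + (1−t)K)`:
**`(K/t − 1)·log(K/4) ≤ t_mix(1/4) ≤ ⌈((K+t)/(t(1−t)))·log((K+b*)/(b*·(1/4)))⌉`.** [ours] -/
theorem hotOnlyPerfectStar_mixingTime_two_sided (hK : 2 ≤ K) (ht0 : 0 < t) (ht1 : t < 1) (hμ : ∀ k x, 0 < μ k x)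
    (hμ1 : ∀ k, ∑ u, μ k u = 1) (hM : ∀ k, IsRowStochastic (M k)) (hMrev : ∀ k, DetailedBalance (μ k) (M k))
    (hM0 : ∀ u v, M 0 u v = μ 0 v) (hperf : ∀ r u, μ (κ r).succ (φ r u) = μ 0 u) {c : ℕ} (hc1 : 1 ≤ c)
    (hc : ∀ p' : Fin K, c ≤ (univ.filter (fun r : Fin m => κ r = p')).card) (hmc : m = c * K)
    (x : Fin (K + 1) → S) (hx : ∑ k : Fin K, μ k.succ (x k.succ) ≤ 1 / 4) :
    ((K : ℝ) / t - 1) * Real.log (K / 4)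
        ≤ (mixingTime (fun y z : Fin (K + 1) → S =>
            t * ptGraphSwap μ (fun r : Fin m => (((0 : Fin (K + 1)), (κ r).succ) : Fin (K + 1) × Fin (K + 1))) φ y z
              + (1 - t) * prodKernel (fun k : Fin (K + 1) => if k = 0 then (1 : ℝ) else 0) M y z) (tensorFun μ)
            (1 / 4) : ℝ) ∧
      mixingTime (fun y z : Fin (K + 1) → S =>
            t * ptGraphSwap μ (fun r : Fin m => (((0 : Fin (K + 1)), (κ r).succ) : Fin (K + 1) × Fin (K + 1))) φ y z
              + (1 - t) * prodKernel (fun k : Fin (K + 1) => if k = 0 then (1 : ℝ) else 0) M y z) (tensorFun μ)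
            (1 / 4)
        ≤ ⌈((K : ℝ) + t) / (t * (1 - t))
            * Real.log (((K : ℝ) + t * ((K : ℝ) + 1) / (t * ((K : ℝ) + 1) + (1 - t) * K))
              / (t * ((K : ℝ) + 1) / (t * ((K : ℝ) + 1) + (1 - t) * K) * (1 / 4)))⌉₊ := by
  have hm : 1 ≤ m := by rw [hmc]; exact Nat.one_le_iff_ne_zero.mpr (Nat.mul_ne_zero (by omega) (by omega))
  have hcm : c ≤ m := by rw [hmc]; exact Nat.le_mul_of_pos_right c (by omega)
  have hw0 : ∀ k : Fin (K + 1), 0 ≤ (if k = 0 then (1 : ℝ) else 0) := fun k => by split_ifs <;> norm_num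
  have hw00 : (0 : ℝ) < (if (0 : Fin (K + 1)) = 0 then (1 : ℝ) else 0) := by rw [if_pos rfl]; norm_num
  have hw1 : ∑ k : Fin (K + 1), (if k = 0 then (1 : ℝ) else 0) = 1 := by
    rw [Finset.sum_ite_eq' univ (0 : Fin (K + 1)), if_pos (mem_univ _)]
  have hstat : ∀ k : Fin (K + 1), k ≠ 0 → ∀ v, ∑ u, μ k u * M k u v = μ k v :=
    fun k _ v => (hMrev k).isStationary (hM k).2 v
  have hcpos : (0 : ℝ) < c := Nat.cast_pos.mpr (by omega)
  have hKpos : (0 : ℝ) < K := Nat.cast_pos.mpr (by omega)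
  constructor
  · have hmix : ∃ t₀, worstTvDist (fun y z : Fin (K + 1) → S =>
        t * ptGraphSwap μ (fun r : Fin m => (((0 : Fin (K + 1)), (κ r).succ) : Fin (K + 1) × Fin (K + 1))) φ y z
          + (1 - t) * prodKernel (fun k : Fin (K + 1) => if k = 0 then (1 : ℝ) else 0) M y z) (tensorFun μ) t₀
          ≤ 1 / 4 :=
      ⟨_, perfectStar_worstTvDist_le_of_ge_log κ φ hm ht0 ht1 hw0 hw00 hw1 hμ hμ1 hM hM0 hstat hperf hc1 hc hcm
        (by norm_num : (0:ℝ) < 1 / 4) (Nat.le_ceil _)⟩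
    exact hotOnlyHub_mixingTime_ge κ φ hK hm hμ hμ1 hM hMrev ht0 ht1.le x hx hmix
  · have h := bestPerfectStar_mixingTime_le κ φ hm ht0 ht1 hw0 hw00 hw1 hμ hμ1 hM hM0 hstat hperf hc1 hc hcm
      (by norm_num : (0:ℝ) < 1 / 4)
    have e0 : (if (0 : Fin (K + 1)) = 0 then (1 : ℝ) else 0) = 1 := if_pos rfl
    have e1 : (t * ((m : ℝ) + c) + (1 - t) * 1 * m) / (t * c * ((1 - t) * 1)) = ((K : ℝ) + t) / (t * (1 - t)) := by
      rw [hmc, Nat.cast_mul]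
      field_simp
      ring
    have e2 : t * ((m : ℝ) + c) / (t * ((m : ℝ) + c) + (1 - t) * 1 * m)
        = t * ((K : ℝ) + 1) / (t * ((K : ℝ) + 1) + (1 - t) * K) := by
      rw [hmc, Nat.cast_mul, div_eq_div_iff (by positivity) (by positivity)]
      ring
    rw [e0, e1, e2] at h
    exact h

end Constants

end Summit.Ventures.LatticeQCDFlow.Scaling

end
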